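import Mathlib
import HarnessLib

/-!
# The invertible-pencil lemma: a pencil of operators mapping `A` isomorphically onto `M` is a line

Family `hodge`, layer `Literature/AlgebraicGeometry/Motives` (pure linear algebra over `ℂ`; no geometry). Research
context: cell `pub-hodge-ring2` (HONEST FRAMING: research route conditional on HC_CM; not a corollary; Q11.4-sentence-2
already refuted in dim ≥ 3), Literature lane gen 87 — a TOOL for the last `p = 37` cell `(15 | 22)` of Ribet's
theorem (`HodgeThetaSubalgebraUnitaryFifteenTwentyTwoReduction`): at a raising operator `B` of minimal rank `m` the
raising elements of `𝔊` anticommuting with `ι_B` and supported on the slot `Q ∩ U⁺ → B(W)` (two spaces of dimension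
`m`) are either `0` or of rank `m`, i.e. isomorphisms of the slot; by this lemma that slot of `𝔊` is the line `ℂ·B`.
UNCONDITIONAL; theorem only, no definition, no named fact (D-0026), no `sorry`.

THE LEMMA. `Z₁, Z₂ ∈ End(W)`, a non-zero subspace `A`, with `Z₂` injective on `A`, `Z₁(A) ⊆ Z₂(A)`, and every member
`Z₁ − c Z₂` of the pencil either zero on `A` or injective on `A` ⟹ `Z₁ = c Z₂` on `A` for some `c` (an eigenvalue of
`Z₂⁻¹ Z₁` on `A`, which exists over `ℂ`). [cite: HoffmanKunze1971LinearAlgebra, §6.2 Thm. 1 and §3.1 Thm. 2]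
[cite: GoodmanWallachGTM255, §4.1.1]

## References
* [HoffmanKunze1971LinearAlgebra] K. Hoffman, R. Kunze, *Linear Algebra* (1971), §6.2 (characteristic values exist
  over an algebraically closed field), §3.1 Thm. 2.
* [GoodmanWallachGTM255] R. Goodman, N. R. Wallach, GTM 255 (2009), §4.1.1.
-/

noncomputable section

open Module

namespace Literature.AlgebraicGeometry.Motives

namespace HodgeStructure

universe u

variable {W : Type u} [AddCommGroup W] [Module ℂ W]

/-- **Invertible-pencil lemma.** If `Z₂` is injective on a non-zero subspace `A`, `Z₁(A) ⊆ Z₂(A)`, and every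
`Z₁ − c • Z₂` is either zero on `A` or injective on `A`, then `Z₁ = c • Z₂` on `A` for some `c : ℂ`.
[cite: HoffmanKunze1971LinearAlgebra, §6.2 Thm. 1] [cite: GoodmanWallachGTM255, §4.1.1] -/
theorem UnitaryInvertiblePencil.exists_eq_smul_on [FiniteDimensional ℂ W] {Z₁ Z₂ : Module.End ℂ W}
    {A : Submodule ℂ W} (hA : A ≠ ⊥) (h₂ : ∀ a ∈ A, Z₂ a = 0 → a = 0) (h₁ : A.map Z₁ ≤ A.map Z₂)
    (hS : ∀ c : ℂ, (∀ a ∈ A, (Z₁ - c • Z₂) a = 0) ∨ (∀ a ∈ A, (Z₁ - c • Z₂) a = 0 → a = 0)) :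
    ∃ c : ℂ, ∀ a ∈ A, Z₁ a = c • Z₂ a := by
  classical
  -- `T : A → A` with `Z₂ (T a) = Z₁ a`
  have hex : ∀ a : A, ∃ b : A, Z₂ (b : W) = Z₁ (a : W) := by
    intro a
    have hmem : Z₁ (a : W) ∈ A.map Z₂ := h₁ (Submodule.mem_map_of_mem a.2)
    obtain ⟨b, hb, hb'⟩ := Submodule.mem_map.1 hmem
    exact ⟨⟨b, hb⟩, hb'⟩
  choose T hT using hex
  have hTlin : ∀ (x y : A) (c : ℂ), T (c • x + y) = c • T x + T y := by
    intro x y c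
    have h0 : Z₂ ((T (c • x + y) : W) - ((c • T x + T y : A) : W)) = 0 := by
      simp only [map_sub, Submodule.coe_add, Submodule.coe_smul, map_add, map_smul, hT, sub_self]
    have h := h₂ _ (Submodule.sub_mem _ (T (c • x + y)).2 (c • T x + T y).2) h0
    exact Subtype.ext (sub_eq_zero.1 h)
  have hT0 : T 0 = 0 := by
    have h := hT 0
    rw [Submodule.coe_zero, map_zero] at h
    exact Subtype.ext (h₂ _ (T 0).2 h)
  let TL : Module.End ℂ A :=
    { toFun := T
      map_add' := fun x y => by simpa using hTlin x y 1
      map_smul' := fun c x => by simpa [hT0] using hTlin x 0 c }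
  have hTL : ∀ a : A, Z₂ ((TL a : A) : W) = Z₁ (a : W) := fun a => hT a
  haveI : Nontrivial A := Submodule.nontrivial_iff_ne_bot.2 hA
  obtain ⟨μ, hμ⟩ := Module.End.exists_eigenvalue TL
  obtain ⟨v, hv⟩ := hμ.exists_hasEigenvector
  have hTv : TL v = μ • v := hv.apply_eq_smul
  have hv0 : v ≠ 0 := hv.2
  refine ⟨μ, ?_⟩
  have hvanish : (Z₁ - μ • Z₂) (v : W) = 0 := by
    rw [LinearMap.sub_apply, LinearMap.smul_apply, ← hTL v, hTv, Submodule.coe_smul, map_smul, sub_self]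
  rcases hS μ with h | h
  · intro a ha
    have := h a ha
    rw [LinearMap.sub_apply, LinearMap.smul_apply, sub_eq_zero] at this
    exact this
  · exact absurd (h v v.2 hvanish) (fun h0 => hv0 (Subtype.ext h0))

end HodgeStructure

end Literature.AlgebraicGeometry.Motives

end
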